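import Summits.Ventures.PackingBounds.Configurations.RegularPolygon
import Summits.Ventures.PackingBounds.Energy.UniversalOptimalityPolygon
import Summits.Ventures.PackingBounds.Configurations.GramIsometry
import Summits.Ventures.PackingBounds.Configurations.GroundStateSeries
import Summits.Ventures.PackingBounds.Energy.CircleEnergyDeficit
import Mathlib.Analysis.SpecialFunctions.Trigonometric.Complex

/-!
# The regular `N`-gon is the unique ground state of `N` points on `S¹` (rigidity of the universal bound)

Framing: lottery ticket; floor = certified bounds/negative ranges. Venture `PackingBounds` (cell
`pub-packcert`, seat `pub-packcert-energy`). Cohn–Kumar (2007, App. A: "uniqueness of the `N`-gon is trivial")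
made formal, for every `N ≥ 2` at once (after `energy_isLeast`: the regular `N`-gon's energy is the least energy of `N`
points on `S¹` for every absolutely monotonic potential — universal optimality + the explicit configuration):

* `inner_mem_of_ckPow_energy_eq`: an `N`-point configuration on `S¹` attaining the universal bound of the
  `(1+t)^k`-energy for one `k ≥ 2⌊N/2⌋` has all pairwise inner products in `{-1} ∪ {cos(2πj/N) : 1 ≤ j ≤ N/2}`
  (deficit inequality `NewtonCert.energy_deficit_circle` + the certificate of `UniversalOptimalityPolygonTable`);
* `isometric_of_inner_mem`: an `N`-point configuration with pairwise inner products in that set is an isometric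
  image of the regular `N`-gon `RegularPolygon.pts N` (polar angles; for odd `N` an antipodal pair is excluded by a
  third point; equal Gram matrices ⇒ isometric, `GramIsometry`);
* `isometric_of_ckPow_energy_eq`, `ground_state_unique_of_absolutelyMonotoneOn`, `riesz_ground_state_unique`:
  every `N`-point ground state on `S¹` of `(1+t)^k` (`k ≥ 2⌊N/2⌋`), of any absolutely monotonic `a` with one
  strictly positive derivative `a^{(k)}(-1)`, `k ≥ 2⌊N/2⌋`, and of every Riesz `s`-energy is a regular `N`-gon.

## References
* H. Cohn, A. Kumar, J. Amer. Math. Soc. 20 (2007) 99–148, Thm. 1.2, Table 1, Appendix A. [`CohnKumar2006`]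
-/

noncomputable section

namespace Summit.Ventures.PackingBounds.Config.RegularPolygonUnique

open Finset Summit.Ventures.PackingBounds.Energy Summit.Ventures.PackingBounds.Energy.UniversalPolygon

/-! ### The ground-state energy -/

/-- **Ground-state energy of `N` points on `S¹`, every `N ≥ 2`.** For every potential `a` absolutely monotonic on
`[-1,1)`, the least `a`-energy of `N` unit vectors of `ℝ²` is `N Σ_{l=1}^{N-1} a(cos(2πl/N))`, attained by the
regular `N`-gon (universal optimality: `Energy.UniversalPolygon`, every `N` at once). [cite: CohnKumar2006, Theorem 1.2] -/
theorem energy_isLeast {N : ℕ} (hN : 2 ≤ N) (a : ℝ → ℝ) (ha : AbsolutelyMonotoneOn a (Set.Ico (-1) 1)) :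
    IsLeast {E : ℝ | ∃ C : Finset (EuclideanSpace ℝ (Fin 2)), (∀ x ∈ C, ‖x‖ = 1) ∧ C.card = N ∧
      E = ∑ x ∈ C, ∑ y ∈ C.erase x, a (inner ℝ x y)}
      ((N : ℝ) * ∑ l ∈ range (N - 1), a (Real.cos (2 * Real.pi * ((l + 1 : ℕ) : ℝ) / N))) := by
  obtain ⟨C, hc, hn1, he⟩ := RegularPolygon.exists_config (show 1 ≤ N by omega)
  refine ⟨⟨C, hn1, hc, (he a).symm⟩, ?_⟩
  rintro E ⟨C', h1, hN', rfl⟩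
  exact Energy.UniversalPolygon.universallyOptimal_of_absolutelyMonotoneOn hN a ha C' h1 hN'

/-! ### Rigidity of the node set -/

/-- **Rigidity (node set).** An `N`-point configuration on `S¹` attaining the universal lower bound of the
`(1+t)^k`-energy for one `k ≥ 2⌊N/2⌋` has all pairwise inner products in `{-1} ∪ {cos(2πj/N) : 1 ≤ j ≤ N/2}`.
[cite: CohnKumar2006, Theorem 1.2] -/
theorem inner_mem_of_ckPow_energy_eq {N : ℕ} (hN : 2 ≤ N) (k : ℕ) (hk : N / 2 + N / 2 ≤ k)
    {C : Finset (EuclideanSpace ℝ (Fin 2))} (h1 : ∀ x ∈ C, ‖x‖ = 1) (hC : C.card = N)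
    (hE : ∑ x ∈ C, ∑ y ∈ C.erase x, (1 + inner ℝ x y) ^ k =
      (N : ℝ) * ∑ l ∈ range (N - 1), (1 + Real.cos (2 * Real.pi * ((l + 1 : ℕ) : ℝ) / N)) ^ k) :
    ∀ x ∈ C, ∀ y ∈ C, x ≠ y →
      inner ℝ x y = -1 ∨ ∃ j : ℕ, 1 ≤ j ∧ j ≤ N / 2 ∧ inner ℝ x y = Real.cos (2 * Real.pi * j / N) := by
  classical
  have hN0 : 0 < N := by omega
  have hdef := NewtonCert.energy_deficit_circle (N / 2 + N / 2) (by omega) (node N) (node_nonneg N)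
    (fun u _ => NewtonCert.omega_doubled_nonneg (node N) (N / 2) (fun i _ => node_add N i) u)
    (G N) (G_nonneg hN0) (fun j hj t => omega_eq hj t) N (N / 2) (by omega) (mult N)
    (fun j hj => design hN hj) k hk C h1 hC
  have hval : (N : ℝ) * ∑ i ∈ range (N / 2), mult N i * node N i ^ k =
      (N : ℝ) * ∑ l ∈ range (N - 1), (1 + Real.cos (2 * Real.pi * ((l + 1 : ℕ) : ℝ) / N)) ^ k := by
    rw [← sum_mult_node hN (fun s => (1 + s) ^ k)]
    exact congrArg _ (Finset.sum_congr rfl fun i _ => by ring_nf)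
  rw [hval, ← hE] at hdef
  -- every pair term `u^{k-D} ω_D(u)` vanishes
  have hnn : ∀ x ∈ C, ∀ y ∈ C.erase x, 0 ≤ (1 + inner ℝ x y) ^ (k - (N / 2 + N / 2)) *
      ∏ i ∈ range (N / 2 + N / 2), (1 + inner ℝ x y - node N i) := by
    intro x hx y hy
    have hb := NewtonCert.inner_mem_Ico_of_norm_eq_one (h1 x hx) (h1 y (Finset.mem_of_mem_erase hy))
      (Finset.ne_of_mem_erase hy).symm
    have hu : (0 : ℝ) ≤ 1 + inner ℝ x y := by linarith [hb.1]
    exact mul_nonneg (pow_nonneg hu _)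
      (NewtonCert.omega_doubled_nonneg (node N) (N / 2) (fun i _ => node_add N i) _)
  have hzero : ∀ x ∈ C, ∀ y ∈ C.erase x, (1 + inner ℝ x y) ^ (k - (N / 2 + N / 2)) *
      ∏ i ∈ range (N / 2 + N / 2), (1 + inner ℝ x y - node N i) = 0 := by
    have htot : ∑ x ∈ C, ∑ y ∈ C.erase x, (1 + inner ℝ x y) ^ (k - (N / 2 + N / 2)) *
        ∏ i ∈ range (N / 2 + N / 2), (1 + inner ℝ x y - node N i) = 0 :=
      le_antisymm (by linarith) (Finset.sum_nonneg fun x hx => Finset.sum_nonneg fun y hy => hnn x hx y hy)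
    intro x hx
    have hx0 := (Finset.sum_eq_zero_iff_of_nonneg fun x hx => Finset.sum_nonneg fun y hy => hnn x hx y hy).1
      htot x hx
    exact fun y hy => (Finset.sum_eq_zero_iff_of_nonneg fun y hy => hnn x hx y hy).1 hx0 y hy
  intro x hx y hy hxy
  have h0 := hzero x hx y (Finset.mem_erase.2 ⟨hxy.symm, hy⟩)
  rcases mul_eq_zero.1 h0 with h | h
  · left
    have := (pow_eq_zero_iff'.1 h).1
    linarith
  · right
    obtain ⟨i, hi, hi0⟩ := Finset.prod_eq_zero_iff.1 h
    have him : i % (N / 2) < N / 2 := Nat.mod_lt _ (by omega)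
    refine ⟨N / 2 - i % (N / 2), by omega, Nat.sub_le _ _, ?_⟩
    rw [← neg_cos_psi N _ him]
    rw [node] at hi0
    linarith

/-! ### Polar angles -/

/-- A polar angle of a point of the plane. [folklore] -/
private def pol (x : EuclideanSpace ℝ (Fin 2)) : ℝ := if 0 ≤ x 1 then Real.arccos (x 0) else -Real.arccos (x 0)

/-- `(cos, sin)` of the polar angle of a unit vector are its coordinates. [folklore] -/
private theorem cos_sin_pol (x : EuclideanSpace ℝ (Fin 2)) (hx : ‖x‖ = 1) :
    Real.cos (pol x) = x 0 ∧ Real.sin (pol x) = x 1 := by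
  have hsq : x 0 ^ 2 + x 1 ^ 2 = 1 := by
    have h := EuclideanSpace.real_norm_sq_eq x
    rw [hx, one_pow, Fin.sum_univ_two] at h
    linarith
  have h0 : -1 ≤ x 0 := by nlinarith [sq_nonneg (x 1), sq_nonneg (x 0 + 1)]
  have h0' : x 0 ≤ 1 := by nlinarith [sq_nonneg (x 1), sq_nonneg (x 0 - 1)]
  have hs : Real.sqrt (1 - x 0 ^ 2) = |x 1| := by
    rw [show 1 - x 0 ^ 2 = x 1 ^ 2 by linarith, Real.sqrt_sq_eq_abs]
  unfold pol
  split_ifs with h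
  · exact ⟨Real.cos_arccos h0 h0', by rw [Real.sin_arccos, hs, abs_of_nonneg h]⟩
  · refine ⟨by rw [Real.cos_neg, Real.cos_arccos h0 h0'], ?_⟩
    rw [Real.sin_neg, Real.sin_arccos, hs, abs_of_neg (lt_of_not_ge h), neg_neg]

/-- A unit vector is `(cos φ, sin φ)` for any angle `φ` with the right cosine and sine. [folklore] -/
private theorem eq_of_cos_sin (x : EuclideanSpace ℝ (Fin 2)) (φ : ℝ) (hc : Real.cos φ = x 0) (hs : Real.sin φ = x 1) :
    x = !₂[Real.cos φ, Real.sin φ] := by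
  ext i
  fin_cases i <;> simp [hc, hs]

/-- Inner products on the circle: `⟨x, y⟩ = cos(φ_x - φ_y)`. [folklore] -/
private theorem inner_eq_cos (x y : EuclideanSpace ℝ (Fin 2)) (hx : ‖x‖ = 1) (hy : ‖y‖ = 1) :
    inner ℝ x y = Real.cos (pol x - pol y) := by
  obtain ⟨hcx, hsx⟩ := cos_sin_pol x hx
  obtain ⟨hcy, hsy⟩ := cos_sin_pol y hy
  rw [Real.cos_sub, hcx, hsx, hcy, hsy, EuclideanSpace.inner_eq_star_dotProduct]
  simp [dotProduct, Fin.sum_univ_two]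
  ring

/-- The regular `N`-gon rotated by `θ₀`: vertices `(cos(θ₀ + 2πj/N), sin(θ₀ + 2πj/N))`. [folklore] -/
private def rv (θ₀ : ℝ) (N : ℕ) (j : Fin N) : EuclideanSpace ℝ (Fin 2) :=
  !₂[Real.cos (θ₀ + RegularPolygon.ang N j), Real.sin (θ₀ + RegularPolygon.ang N j)]

/-- The rotated `N`-gon has the Gram matrix of the standard one. [folklore] -/
private theorem inner_rv (θ₀ : ℝ) (N : ℕ) (j j' : Fin N) :
    inner ℝ (rv θ₀ N j) (rv θ₀ N j') = inner ℝ (RegularPolygon.pt N j) (RegularPolygon.pt N j') := by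
  rw [RegularPolygon.inner_pt]
  have h : inner ℝ (rv θ₀ N j) (rv θ₀ N j') =
      Real.cos (θ₀ + RegularPolygon.ang N j') * Real.cos (θ₀ + RegularPolygon.ang N j) +
        Real.sin (θ₀ + RegularPolygon.ang N j') * Real.sin (θ₀ + RegularPolygon.ang N j) := by
    simp [rv, EuclideanSpace.inner_toLp_toLp, dotProduct, Fin.sum_univ_two]
  rw [h, show 2 * Real.pi * ((j : ℝ) - j') / N = (θ₀ + RegularPolygon.ang N j) - (θ₀ + RegularPolygon.ang N j') by
    unfold RegularPolygon.ang; ring, Real.cos_sub]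
  ring

/-- A unit vector whose polar angle is `θ₀ + 2πz/N` for an integer `z` is a vertex of the rotated `N`-gon.
[folklore] -/
private theorem exists_eq_rv {N : ℕ} (hN : 0 < N) (θ₀ : ℝ) (y : EuclideanSpace ℝ (Fin 2)) (hy : ‖y‖ = 1)
    (hz : ∃ z : ℤ, pol y = θ₀ + 2 * Real.pi * z / N) : ∃ j : Fin N, y = rv θ₀ N j := by
  obtain ⟨z, hz⟩ := hz
  have hNz : (0 : ℤ) < N := by exact_mod_cast hN
  have hmod : 0 ≤ z % N := Int.emod_nonneg _ hNz.ne'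
  have hlt : z % N < N := Int.emod_lt_of_pos _ hNz
  refine ⟨⟨(z % N).toNat, by omega⟩, ?_⟩
  obtain ⟨hc, hs⟩ := cos_sin_pol y hy
  have hang : pol y = θ₀ + RegularPolygon.ang N ((z % N).toNat) + (z / N : ℤ) * (2 * Real.pi) := by
    rw [hz, RegularPolygon.ang]
    have h1 : (((z % N).toNat : ℕ) : ℝ) = ((z % N : ℤ) : ℝ) := by exact_mod_cast Int.toNat_of_nonneg hmod
    have h2 : (z : ℝ) = (N : ℝ) * ((z / N : ℤ) : ℝ) + ((z % N : ℤ) : ℝ) := by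
      have h := Int.emod_add_mul_ediv z N
      have h' : (((z % N + N * (z / N) : ℤ)) : ℝ) = (z : ℝ) := by rw [h]
      push_cast at h'
      linarith
    rw [h1, h2]
    field_simp
    ring
  rw [eq_of_cos_sin y (pol y) hc hs, rv, hang, Real.cos_add_int_mul_two_pi, Real.sin_add_int_mul_two_pi]

/-! ### The structure theorem -/

/-- **An `N`-point configuration on `S¹` with the `N`-gon's inner products is a rotated regular `N`-gon**, hence
an isometric image of `RegularPolygon.pts N`. [cite: CohnKumar2006, Appendix A] -/
theorem isometric_of_inner_mem {N : ℕ} (hN : 2 ≤ N) {C : Finset (EuclideanSpace ℝ (Fin 2))}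
    (h1 : ∀ x ∈ C, ‖x‖ = 1) (hC : C.card = N)
    (hin : ∀ x ∈ C, ∀ y ∈ C, x ≠ y →
      inner ℝ x y = -1 ∨ ∃ j : ℕ, 1 ≤ j ∧ j ≤ N / 2 ∧ inner ℝ x y = Real.cos (2 * Real.pi * j / N)) :
    ∃ Ψ : EuclideanSpace ℝ (Fin 2) ≃ₗᵢ[ℝ] EuclideanSpace ℝ (Fin 2), C = (RegularPolygon.pts N).image Ψ := by
  classical
  have hN0 : 0 < N := by omega
  have hNr : (0 : ℝ) < N := by exact_mod_cast hN0
  obtain ⟨x₀, hx₀⟩ : C.Nonempty := by rw [← Finset.card_pos, hC]; omega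
  set θ₀ := pol x₀ with hθ₀
  -- an angle difference with cosine `cos(2πj/N)` is `2πz/N` for an integer `z`
  have hcase : ∀ y ∈ C, (∃ j : ℕ, Real.cos (pol y - θ₀) = Real.cos (2 * Real.pi * j / N)) →
      ∃ z : ℤ, pol y = θ₀ + 2 * Real.pi * z / N := by
    intro y _ ⟨j, hj⟩
    obtain ⟨kk, hk⟩ := Real.cos_eq_cos_iff.1 hj.symm
    rcases hk with hk | hk
    · refine ⟨kk * N + j, ?_⟩
      push_cast
      have : pol y = θ₀ + (2 * kk * Real.pi + 2 * Real.pi * j / N) := by linarith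
      rw [this]; field_simp
    · refine ⟨kk * N - j, ?_⟩
      push_cast
      have : pol y = θ₀ + (2 * kk * Real.pi - 2 * Real.pi * j / N) := by linarith
      rw [this]; field_simp
  -- every point is a vertex of the `N`-gon rotated by `θ₀`
  have hmem : ∀ y ∈ C, ∃ j : Fin N, y = rv θ₀ N j := by
    intro y hy
    refine exists_eq_rv hN0 θ₀ y (h1 y hy) ?_
    by_cases hyx : y = x₀
    · exact ⟨0, by simp [hyx, hθ₀]⟩
    rcases hin y hy x₀ hx₀ hyx with hneg | ⟨j, -, -, hj⟩
    · -- antipodal to `x₀`: fine for even `N`, impossible for odd `N`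
      rw [inner_eq_cos y x₀ (h1 y hy) (h1 x₀ hx₀)] at hneg
      rcases Nat.even_or_odd N with ⟨m, hm⟩ | hodd
      · refine hcase y hy ⟨N / 2, ?_⟩
        rw [hneg, show ((N / 2 : ℕ) : ℝ) = (N : ℝ) / 2 by
          rw [show N / 2 = m by omega]; rw [hm]; push_cast; ring]
        rw [show 2 * Real.pi * ((N : ℝ) / 2) / N = Real.pi by field_simp, Real.cos_pi]
      · exfalso
        -- a third point `z`
        have h3 : 3 ≤ N := by rcases hodd with ⟨m, hm⟩; omega
        obtain ⟨z, hz, hzx, hzy⟩ : ∃ z ∈ C, z ≠ x₀ ∧ z ≠ y := by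
          have hcard : 0 < ((C.erase x₀).erase y).card := by
            rw [Finset.card_erase_of_mem (Finset.mem_erase.2 ⟨hyx, hy⟩), Finset.card_erase_of_mem hx₀, hC]
            omega
          obtain ⟨z, hz⟩ := Finset.card_pos.1 hcard
          exact ⟨z, Finset.mem_of_mem_erase (Finset.mem_of_mem_erase hz),
            Finset.ne_of_mem_erase (Finset.mem_of_mem_erase hz), Finset.ne_of_mem_erase hz⟩
        obtain ⟨kk, hk⟩ := Real.cos_eq_neg_one_iff.1 hneg
        rcases hin z hz x₀ hx₀ hzx with hzneg | ⟨j, hj1, hj2, hj⟩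
        · -- `z` also antipodal: then `z = y`
          rw [inner_eq_cos z x₀ (h1 z hz) (h1 x₀ hx₀)] at hzneg
          obtain ⟨kk', hk'⟩ := Real.cos_eq_neg_one_iff.1 hzneg
          obtain ⟨hcz, hsz⟩ := cos_sin_pol z (h1 z hz)
          obtain ⟨hcy, hsy⟩ := cos_sin_pol y (h1 y hy)
          have hpz : pol z = pol y + ((kk' - kk : ℤ) : ℝ) * (2 * Real.pi) := by push_cast; linarith
          apply hzy
          rw [eq_of_cos_sin z (pol z) hcz hsz, eq_of_cos_sin y (pol y) hcy hsy, hpz, Real.cos_add_int_mul_two_pi,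
            Real.sin_add_int_mul_two_pi]
        · -- `⟨y, z⟩ = -cos(2πj/N)` is not an allowed inner product when `N` is odd
          rw [inner_eq_cos z x₀ (h1 z hz) (h1 x₀ hx₀)] at hj
          have hyz : inner ℝ y z = -Real.cos (2 * Real.pi * j / N) := by
            rw [inner_eq_cos y z (h1 y hy) (h1 z hz), show pol y - pol z = (pol y - θ₀) - (pol z - θ₀) by ring,
              Real.cos_sub, ← hk, hj, Real.cos_add_int_mul_two_pi, Real.sin_add_int_mul_two_pi, Real.cos_pi,
              Real.sin_pi]
            ring
          have hj0 : 0 < 2 * Real.pi * j / N := by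
            have : (0 : ℝ) < j := by exact_mod_cast hj1
            positivity
          have hjpi : 2 * Real.pi * j / N ≤ Real.pi := by
            rw [div_le_iff₀ hNr]
            have : 2 * (j : ℝ) ≤ N := by exact_mod_cast (show 2 * j ≤ N by omega)
            nlinarith [Real.pi_pos]
          rcases hin y hy z hz hzy.symm with h' | ⟨j', hj1', hj2', hj'⟩
          · rw [hyz, neg_inj] at h'
            have := (Real.cos_eq_one_iff_of_lt_of_lt (by linarith [Real.pi_pos]) (by linarith [Real.pi_pos])).1 h'
            linarith
          · rw [hyz, ← Real.cos_pi_sub] at hj'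
            have hj0' : 0 < 2 * Real.pi * j' / N := by
              have : (0 : ℝ) < j' := by exact_mod_cast hj1'
              positivity
            have hjpi' : 2 * Real.pi * j' / N ≤ Real.pi := by
              rw [div_le_iff₀ hNr]
              have : 2 * (j' : ℝ) ≤ N := by exact_mod_cast (show 2 * j' ≤ N by omega)
              nlinarith [Real.pi_pos]
            have heq := Real.injOn_cos ⟨by linarith, by linarith⟩ ⟨hj0'.le, hjpi'⟩ hj'
            have hNeq : (N : ℝ) = 2 * ((j : ℝ) + j') := by
              field_simp at heq
              nlinarith [Real.pi_pos]
            have hNn : N = 2 * (j + j') := by exact_mod_cast hNeq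
            rcases hodd with ⟨m, hm⟩
            omega
    · rw [inner_eq_cos y x₀ (h1 y hy) (h1 x₀ hx₀)] at hj
      exact hcase y hy ⟨j, hj⟩
  -- hence `C` is the image of the rotated `N`-gon, which is isometric to the standard one
  have hsub : C ⊆ (univ : Finset (Fin N)).image (rv θ₀ N) := by
    intro y hy
    obtain ⟨j, rfl⟩ := hmem y hy
    exact Finset.mem_image_of_mem _ (Finset.mem_univ j)
  have hCeq : C = (univ : Finset (Fin N)).image (rv θ₀ N) :=
    Finset.eq_of_subset_of_card_le hsub (by
      rw [hC]; exact Finset.card_image_le.trans (by simp))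
  obtain ⟨Ψ, hΨ⟩ := exists_linearIsometryEquiv_of_inner_eq (RegularPolygon.pt N) (rv θ₀ N)
    (fun j j' => (inner_rv θ₀ N j j').symm)
  refine ⟨Ψ, ?_⟩
  rw [hCeq, RegularPolygon.pts, Finset.image_image]
  exact Finset.image_congr fun j _ => (hΨ j).symm

/-! ### Ground states -/

/-- **Rigidity of the universal bound on `S¹`.** An `N`-point configuration on `S¹` (`N ≥ 2`) with the regular
`N`-gon's `(1+t)^k`-energy for one `k ≥ 2⌊N/2⌋` is an isometric image of the regular `N`-gon.
[cite: CohnKumar2006, Theorem 1.2 and Appendix A] -/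
theorem isometric_of_ckPow_energy_eq {N : ℕ} (hN : 2 ≤ N) (k : ℕ) (hk : N / 2 + N / 2 ≤ k)
    {C : Finset (EuclideanSpace ℝ (Fin 2))} (h1 : ∀ x ∈ C, ‖x‖ = 1) (hC : C.card = N)
    (hE : ∑ x ∈ C, ∑ y ∈ C.erase x, (1 + inner ℝ x y) ^ k =
      (N : ℝ) * ∑ l ∈ range (N - 1), (1 + Real.cos (2 * Real.pi * ((l + 1 : ℕ) : ℝ) / N)) ^ k) :
    ∃ Ψ : EuclideanSpace ℝ (Fin 2) ≃ₗᵢ[ℝ] EuclideanSpace ℝ (Fin 2), C = (RegularPolygon.pts N).image Ψ :=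
  isometric_of_inner_mem hN h1 hC (inner_mem_of_ckPow_energy_eq hN k hk h1 hC hE)

/-- **Unique ground state for absolutely monotonic potentials.** If `a` is absolutely monotonic on `[-1,1)` with
`a^{(k₀)}(-1) > 0` for some `k₀ ≥ 2⌊N/2⌋`, every `N`-point configuration on `S¹` whose `a`-energy equals the regular
`N`-gon's value `N Σ_{l=1}^{N-1} a(cos(2πl/N))` (the minimum, `energy_isLeast`) is an isometric
image of the regular `N`-gon. [cite: CohnKumar2006, Theorem 1.2 and Appendix A] -/
theorem ground_state_unique_of_absolutelyMonotoneOn {N : ℕ} (hN : 2 ≤ N) (a : ℝ → ℝ)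
    (ha : AbsolutelyMonotoneOn a (Set.Ico (-1) 1)) {k₀ : ℕ} (hk₀ : N / 2 + N / 2 ≤ k₀)
    (hpos : 0 < iteratedDerivWithin k₀ a (Set.Ico (-1) 1) (-1))
    {C : Finset (EuclideanSpace ℝ (Fin 2))} (h1 : ∀ x ∈ C, ‖x‖ = 1) (hC : C.card = N)
    (hE : ∑ x ∈ C, ∑ y ∈ C.erase x, a (inner ℝ x y) =
      (N : ℝ) * ∑ l ∈ range (N - 1), a (Real.cos (2 * Real.pi * ((l + 1 : ℕ) : ℝ) / N))) :
    ∃ Ψ : EuclideanSpace ℝ (Fin 2) ≃ₗᵢ[ℝ] EuclideanSpace ℝ (Fin 2), C = (RegularPolygon.pts N).image Ψ := by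
  have hN0 : (0 : ℝ) < N := by exact_mod_cast (show 0 < N by omega)
  -- the bound data indexed by `Fin (N-1)`
  set t : Fin (N - 1) → ℝ := fun l => Real.cos (2 * Real.pi * ((l + 1 : ℕ) : ℝ) / N) with htdef
  have hfin : ∀ g : ℝ → ℝ, ∑ i : Fin (N - 1), (1 : ℝ) * g (t i) =
      ∑ l ∈ range (N - 1), g (Real.cos (2 * Real.pi * ((l + 1 : ℕ) : ℝ) / N)) := by
    intro g
    simp only [one_mul, htdef]
    exact Fin.sum_univ_eq_sum_range (fun l => g (Real.cos (2 * Real.pi * ((l + 1 : ℕ) : ℝ) / N))) (N - 1)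
  have ht : ∀ i : Fin (N - 1), -1 ≤ t i ∧ t i < 1 := by
    intro i
    refine ⟨Real.neg_one_le_cos _, lt_of_le_of_ne (Real.cos_le_one _) fun h => ?_⟩
    have hlo : 0 < 2 * Real.pi * (((i : ℕ) + 1 : ℕ) : ℝ) / N := by positivity
    have hhi : 2 * Real.pi * (((i : ℕ) + 1 : ℕ) : ℝ) / N < 2 * Real.pi := by
      rw [div_lt_iff₀ hN0]
      have : ((((i : ℕ) + 1 : ℕ)) : ℝ) < N := by exact_mod_cast (show (i : ℕ) + 1 < N by omega)
      nlinarith [Real.pi_pos]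
    have := (Real.cos_eq_one_iff_of_lt_of_lt (by linarith) hhi).1 h
    linarith
  have hEB : ∀ k, (N : ℝ) * ∑ i : Fin (N - 1), 1 * (1 + t i) ^ k ≤
      ∑ x ∈ C, ∑ y ∈ C.erase x, (1 + inner ℝ x y) ^ k := by
    intro k; rw [hfin (fun s => (1 + s) ^ k)]; exact ckPow_energy_ge hN k C h1 hC
  have hE' : ∑ x ∈ C, ∑ y ∈ C.erase x, a (inner ℝ x y) = (N : ℝ) * ∑ i : Fin (N - 1), 1 * a (t i) := by
    rw [hfin a]; exact hE
  have hk := GroundStateSeries.ckPow_energy_eq_of_absolutelyMonotoneOn h1 N t (fun _ => 1) ht hEB a ha hpos hE'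
  rw [hfin (fun s => (1 + s) ^ k₀)] at hk
  exact isometric_of_ckPow_energy_eq hN k₀ hk₀ h1 hC hk

/-- **Unique ground state for the Riesz energies.** For every `s > 0`, every `N`-point configuration on `S¹` whose
Riesz `s`-energy `Σ_{x ≠ y} |x-y|^{-2s} = Σ (2 - 2⟨x,y⟩)^{-s}` equals the regular `N`-gon's is an isometric image of the
regular `N`-gon. [cite: CohnKumar2006, Theorem 1.2 and Appendix A] -/
theorem riesz_ground_state_unique {N : ℕ} (hN : 2 ≤ N) (s : ℝ) (hs : 0 < s)
    {C : Finset (EuclideanSpace ℝ (Fin 2))} (h1 : ∀ x ∈ C, ‖x‖ = 1) (hC : C.card = N)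
    (hE : ∑ x ∈ C, ∑ y ∈ C.erase x, (2 - 2 * inner ℝ x y) ^ (-s) =
      (N : ℝ) * ∑ l ∈ range (N - 1), (2 - 2 * Real.cos (2 * Real.pi * ((l + 1 : ℕ) : ℝ) / N)) ^ (-s)) :
    ∃ Ψ : EuclideanSpace ℝ (Fin 2) ≃ₗᵢ[ℝ] EuclideanSpace ℝ (Fin 2), C = (RegularPolygon.pts N).image Ψ :=
  ground_state_unique_of_absolutelyMonotoneOn hN (fun u : ℝ => (2 - 2 * u) ^ (-s))
    (Energy.RieszAbsolutelyMonotone.absolutelyMonotoneOn_rpow_chordal s hs.le) le_rfl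
    (E8GroundState.iteratedDerivWithin_rpow_chordal_pos s hs _) h1 hC hE

end Summit.Ventures.PackingBounds.Config.RegularPolygonUnique

end
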